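import Mathlib.NumberTheory.Modular
import Mathlib.LinearAlgebra.Matrix.SpecialLinearGroup
import Mathlib.Analysis.Asymptotics.Defs
import Mathlib.Analysis.Calculus.ContDiff.Operations
import Mathlib.Analysis.SpecialFunctions.Pow.Real
import Mathlib.Analysis.SpecialFunctions.Log.Basic
import Mathlib.MeasureTheory.Integral.IntervalIntegral.Basic
import HarnessLib

/-!
# Horocycle flow on the modular unit tangent bundle: Flaminio–Forni's invariant-distribution
# expansion (obstruction catalogue) and its typed shadow for closed cuspidal horocycles

Topic `Literature/Dynamics/Homogeneous` (cite item `wi-03973`, route `RiemannHypothesis/Horocycle`,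
whose kill criterion (ii) refers to this paper).  Companion of
`Literature/NumberTheory/LFunctions/HorocycleEquidistribution.lean` (`Literature.NumberTheory.LFunctions.zagier_sarnak_horocycle_rate_half`,
the SURFACE case: `SL(2,ℤ)`-invariant functions on `ℍ`, rate `O(y^{1/2})`, Sarnak 1981 Thm 1) — the
present file is the FRAME-FLOW version on `SM = PSL(2,ℤ)\PSL(2,ℝ)` which the route deliberately
left undecomposed ("no `Γ\SL₂(ℝ)` (frame-flow) version").

## Source (held: `paper:doi-10-1215-s0012-7094-03-11932-8`, 50 pp.; page numbers of that PDF)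

L. Flaminio, G. Forni, *Invariant distributions and time averages for horocycle flows*, Duke
Math. J. 119 (2003) 465–526.  Setting (pp. 3–4): `M = Γ\ℍ` a hyperbolic surface of finite area,
`SM = Γ\PSL(2,ℝ)`, `U = (0 1; 0 0)` generates the (stable) horocycle flow `φ^U_t`, `X = diag(1/2,
−1/2)` the geodesic flow; `W^s(SM)` the Sobolev spaces of the (elliptic) Laplacian `Δ = −(X²+Y²+Θ²)`;
`𝓘(SM) = {D ∈ 𝓔'(SM) | 𝓛_U D = 0}` the `U`-invariant distributions; `σ_pp` the eigenvalues of
`Δ_M`, `𝓒` the cusps.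

**The obstruction catalogue (informal; not typable at HEAD — no unitary representations of
`PSL(2,ℝ)`, Sobolev spaces or distributions on `Γ\G` in the tree).**

* **Thm 1.1 (p. 4).** `𝓘(SM) = ⊕_{μ ∈ σ_pp} 𝓘_μ ⊕ ⊕_{n ≥ 1} 𝓘_n ⊕ ⊕_{c ∈ 𝓒} 𝓘_c`; `𝓘_0` = the
  invariant volume; for `0 < μ < 1/4`, `𝓘_μ = 𝓘_μ⁺ ⊕ 𝓘_μ⁻ ⊂ W^{-s}` iff `s > (1 ± √(1−4μ))/2`, each of
  dimension the multiplicity of `μ`; for `μ ≥ 1/4`, `𝓘_μ ⊂ W^{-s}` iff `s > 1/2` (dimension twice the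
  multiplicity); `𝓘_n ⊂ W^{-s}` iff `s > n` (dimension twice the rank of holomorphic sections of
  `K^n`); `𝓘_c ⊂ W^{-s}` iff `s > 1/2`, infinite countable dimension.  Sobolev orders (3):
  `S_D = (1 ± Re √(1−4μ))/2`, `n`, `1/2` respectively.
* **Thm 1.2–1.3 (p. 5).** `𝓘^s(SM)` is a complete set of obstructions to solving `Uf = g`,
  `g ∈ W^s`, with loss of regularity governed by `ν₀ = √(1−4μ₀)` (`μ₀` the spectral gap), and
  distributions of order `S_D < s` obstruct solutions in `W^t`, `t ≥ S_D − 1`.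
* **Thm 1.4 (pp. 5–6).** The geodesic flow acts on `𝓘(SM)` with `φ^X_t | 𝓘_μ^± = e^{−(1 ± √(1−4μ))t/2}`
  (`μ ≠ 1/4`; a `2×2` Jordan block at `μ = 1/4`), `φ^X_t | 𝓘_n = e^{−nt}`, and Lebesgue spectrum on
  `𝓘_𝓒 = ⊕ 𝓘_c` supported on `|z| = e^{−t/2}`.
* **Thm 1.5 (p. 7, COMPACT `M`).** For `s > 3`, `f ∈ W^s(SM)`, all `(x, T)`:
  `(1/T) ∫₀ᵀ f(φ^U_t x) dt = ∫ f dvol + Σ_{D ∈ 𝓑⁺ ∖ 𝓑_{1/4}⁺} c_D(x,T) D(f) T^{−S_D}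
  + Σ_{D ∈ 𝓑_{1/4}⁺} c_D(x,T) D(f) T^{−S_D} log⁺T + 𝓓(x,T)(f) (log⁺T)/T + 𝓡(x,T)(f)/T`, with
  `Σ|c_D|² ≤ C(s)`, `‖𝓓‖_{−s}, ‖𝓡‖_{−s} ≤ C(s)`, and `‖c_D(·,T)‖₀ ≥ C(D,s) > 0` for large `T`
  (whence no CLT, Cor. 1.6).
* **Thm 1.7 (p. 8, FINITE AREA, non-compact) / Thm 5.14 (p. 43).** For `s > 3` the geodesic
  push-forwards `φ^X_t(γ_{x,T})` (horocycle arcs of length `T_t = eᵗ T`) satisfy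
  `φ^X_t(γ_{x,T})(f) = ∫ f dvol + Σ_{D ∈ 𝓑⁺_{1/2}} c_D(x,T,t) D(f) T_t^{−S_D} + 𝓡(x,T,t)(f) T_t^{−1/2} log² T_t`,
  where `𝓑⁺_{1/2} = ⋃_{μ ∈ σ_pp ∩ (0,1/4)} 𝓑_μ` is FINITE, "empty for hyperbolic surfaces satisfying
  the Selberg's conjecture" (p. 8), and Selberg's conjecture "is known to be true for all congruence
  subgroups `Γ > Γ(N)`, `N ≤ 17`" (p. 3) — in particular for `Γ(1) = PSL(2,ℤ)`.
* **Prop 5.15 (p. 44, CLOSED CUSPIDAL horocycles).** For `s > 2` and `γ_{x,T}` a closed cuspidal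
  horocycle there are constants `c_D ∈ ℂ` (`D ∈ 𝓑⁺_{1/2}`) and a uniformly bounded
  `𝓒^s(t) ∈ 𝓘_𝓒 ⊂ W^{−s}` with, for all `t ≥ 0`,
  `φ^X_t(γ_{x,T})(f) = ∫ f dvol + Σ_{D ∈ 𝓑⁺_{1/2}} c_D D(f) T_t^{−S_D} + 𝓒^s(t)(f) T_t^{−1/2} log T_t`.
  FF add (p. 8): Sarnak [51] has the sharper `o(T^{−1/2})` by Eisenstein series, "taking into account
  the explicit spectral decomposition of cuspidal horocycles and the absolute continuity of the
  continuous part of the spectrum. In the particular case of the modular group, the remainder term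
  for cuspidal horocycles is `O(T^{−3/4+ε})`, for all `ε > 0`, iff the Riemann hypothesis holds
  [58], [51]."  (So the `ρ`-indexed terms `T^{−(1 − ρ/2)}`… of the route's thesis live INSIDE the
  cusp component `𝓘_𝓒`, i.e. in the Eisenstein-series part; FF's representation-theoretic method
  sees them only as the `T^{−1/2} log T` remainder — this is the precise content behind the route's
  "obstructions" caveat: a dynamical rate gain beyond `1/2` must control the `𝓘_𝓒`-component.)

## What is typed

`Literature.Dynamics.Homogeneous.flaminioForni_closedHorocycle_modular` — the consequence of Prop 5.15 + (p. 3, p. 8: `𝓑⁺_{1/2}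
= ∅` for the modular group) for the smallest honest test-function class, `C_c^∞(SL(2,ℤ)\SL(2,ℝ))
⊂ W^s(SM)` (all `s`): for `f : SL(2,ℝ) → ℂ` smooth (restriction of a `C^∞` function of the four
matrix entries), left `SL(2,ℤ)`-invariant (as `−I ∈ SL(2,ℤ)`, exactly a function on
`PSL(2,ℤ)\PSL(2,ℝ)`) and vanishing high in the cusp, the averages over the closed cuspidal
horocycles `{Γ n(x) a(y) : 0 ≤ x ≤ 1}` (`n(x) a(y) = (√y, x/√y; 0, 1/√y)`, the frame at `x + iy`
pointing up; length `T = 1/y` for the flow `g ↦ g·n(t)` since `a(y) n(t) = n(yt) a(y)`) satisfy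
`∫₀¹ f(n(x)a(y)) dx = c + O(y^{1/2} log(1/y))` as `y → 0⁺`.
Conventions check: FF's `γ_{x,T}` runs along the horocycles EXPANDED by `φ^X_t` (p. 8; p. 43 says
"stable", p. 8 "unstable" — the paper's wording is not consistent, the mathematics is symmetric):
the flip `w = (0 1; −1 0) ∈ SO(2)` conjugates `n(t)` to the opposite unipotent and normalises `A`,
and `f ↦ f(· w)` preserves the test-function class below (`w ∈ K` fixes `g • i`), so the statement
for the family `{Γ n(x) a(y)}` follows for either reading.  The base horocycle is the one of length
`1` (`y = 1`); `T_t = eᵗ` then sweeps all `y = e^{−t} ∈ (0, 1]`, and `|𝓒^s(t)(f)| ≤ sup_t ‖𝓒^s(t)‖_{−s}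
‖f‖_s` gives the `O`.  We use `∃ c` (the constant is `∫ f dvol` for the probability Haar measure,
which we do not build) and `=O` at `0⁺` only (Prop 5.15 is an asymptotic statement; at `T_t = 1`
its `log` vanishes).  This typed shadow is WEAKER than Sarnak's Thm 1 for the same class; its
point is to pin the frame-flow objects (`SL(2,ℝ)`, `n(x)a(y)`, cusp support) for the route.
-/

noncomputable section

open scoped MatrixGroups

namespace Literature.Dynamics.Homogeneous

/-- The frame `n(x) a(y) = (√y, x/√y; 0, 1/√y) ∈ SL(2,ℝ)` over the point `x + iy ∈ ℍ` (unit tangent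
vector pointing straight up); for fixed `y > 0`, `x ∈ [0,1]` parametrises the closed cuspidal
horocycle of length `1/y` on `SL(2,ℤ)\SL(2,ℝ)`.  Junk value `1` for `y ≤ 0`.
[cite: FlaminioForni2003, §1 pp. 3, 8 (U, X, cuspidal horocycles)] -/
def modularHorocycleFrame (x y : ℝ) : SL(2, ℝ) :=
  if hy : 0 < y then
    ⟨!![Real.sqrt y, x / Real.sqrt y; 0, (Real.sqrt y)⁻¹], by
      have h : Real.sqrt y ≠ 0 := (Real.sqrt_pos.2 hy).ne'
      simp [Matrix.det_fin_two, h]⟩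
  else 1

/-- The entries of `modularHorocycleFrame x y` for `y > 0`. [folklore] -/
theorem modularHorocycleFrame_coe {x y : ℝ} (hy : 0 < y) :
    ((modularHorocycleFrame x y : SL(2, ℝ)) : Matrix (Fin 2) (Fin 2) ℝ) =
      !![Real.sqrt y, x / Real.sqrt y; 0, (Real.sqrt y)⁻¹] := by
  simp [modularHorocycleFrame, hy]

/-- Junk value: `modularHorocycleFrame x y = 1` for `y ≤ 0`. [folklore] -/
theorem modularHorocycleFrame_of_nonpos {x y : ℝ} (hy : y ≤ 0) : modularHorocycleFrame x y = 1 := by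
  simp [modularHorocycleFrame, not_lt.2 hy]

/-- The frame `n(x) a(y)` sits over the point `x + iy`: `n(x)a(y) • i = x + iy`. [folklore] -/
theorem modularHorocycleFrame_smul_I {x y : ℝ} (hy : 0 < y) :
    ((modularHorocycleFrame x y • UpperHalfPlane.I : UpperHalfPlane) : ℂ) = x + y * Complex.I := by
  rw [UpperHalfPlane.coe_specialLinearGroup_apply]
  have hs : 0 < Real.sqrt y := Real.sqrt_pos.2 hy
  have hsC : (Real.sqrt y : ℂ) ≠ 0 := by exact_mod_cast hs.ne'
  have hsq : ((Real.sqrt y : ℂ)) ^ 2 = (y : ℂ) := by rw [← Complex.ofReal_pow, Real.sq_sqrt hy.le]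
  simp [modularHorocycleFrame_coe hy, UpperHalfPlane.coe_I]
  rw [add_mul, div_mul_cancel₀ _ hsC]
  linear_combination Complex.I * hsq

/-- **Test functions on the modular unit tangent bundle** `SL(2,ℤ)\SL(2,ℝ)` (`= PSL(2,ℤ)\PSL(2,ℝ)`
since `−I ∈ SL(2,ℤ)`): `f : SL(2,ℝ) → ℂ` is the restriction of a `C^∞` function of the matrix
entries, is left `SL(2,ℤ)`-invariant, and vanishes at frames over points of the standard
fundamental domain of height `> Y` (with invariance: compact support on `Γ\G`, the fibre `SO(2)`
being compact).  Such `f` lie in every Sobolev space `W^s(SM)` of Flaminio–Forni.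
[cite: FlaminioForni2003, §2.1 p. 9 (W^s, C^∞ vectors)] -/
def IsModularFrameTestFunction (f : SL(2, ℝ) → ℂ) : Prop :=
  (∃ F : (Fin 2 → Fin 2 → ℝ) → ℂ, ContDiff ℝ (⊤ : ℕ∞) F ∧
      ∀ g : SL(2, ℝ), f g = F (Matrix.of.symm (g : Matrix (Fin 2) (Fin 2) ℝ))) ∧
    (∀ (γ : SL(2, ℤ)) (g : SL(2, ℝ)), f ((γ : SL(2, ℝ)) * g) = f g) ∧
    ∃ Y : ℝ, ∀ g : SL(2, ℝ), g • UpperHalfPlane.I ∈ ModularGroup.fd →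
      Y < (g • UpperHalfPlane.I).im → f g = 0

/-- **Flaminio–Forni, closed cuspidal horocycles on the modular unit tangent bundle** (Duke 119
(2003), Prop. 5.15 with Thm 1.7 and pp. 3, 8: for `Γ = PSL(2,ℤ)` there are no Laplace eigenvalues
in `(0, 1/4)`, so the finite family `𝓑⁺_{1/2}` of invariant-distribution terms is empty and only the
cusp remainder `𝓒^s(t)(f) T^{−1/2} log T`, `𝓒^s(t) ∈ 𝓘_𝓒` uniformly bounded in `W^{−s}`, survives).
For every test function `f` on `SL(2,ℤ)\SL(2,ℝ)` (`IsModularFrameTestFunction`: smooth, left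
`SL(2,ℤ)`-invariant, compactly supported modulo `SL(2,ℤ)`), the average of `f` over the closed
cuspidal horocycle of length `T = 1/y`, `∫₀¹ f(n(x) a(y)) dx`, converges to a constant `c`
(`= ∫ f dvol`) with error `O(T^{−1/2} log T) = O(y^{1/2} log(1/y))` as `y → 0⁺`.
(Sarnak 1981 has `O(T^{−1/2})` by Eisenstein series; for the modular group `O(T^{−3/4+ε}) ∀ε` iff
RH — FF p. 8.) [cite: FlaminioForni2003, Prop. 5.15 (p. 44) with Thm 1.7 and pp. 3, 8] -/
def flaminioForni_closedHorocycle_modular : Prop :=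
  ∀ f : SL(2, ℝ) → ℂ, IsModularFrameTestFunction f →
    ∃ c : ℂ, Asymptotics.IsBigO (nhdsWithin (0 : ℝ) (Set.Ioi 0))
      (fun y : ℝ => (∫ x in (0 : ℝ)..1, f (modularHorocycleFrame x y)) - c)
      (fun y : ℝ => y ^ (1 / 2 : ℝ) * Real.log (1 / y))

/-! ### Small API -/

/-- The zero function is a test function. [folklore] -/
theorem isModularFrameTestFunction_zero : IsModularFrameTestFunction (fun _ => 0) :=
  ⟨⟨fun _ => 0, contDiff_const, fun _ => rfl⟩, fun _ _ => rfl, ⟨0, fun _ _ _ => rfl⟩⟩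

/-- Test functions form a `ℂ`-submodule: closure under addition. [folklore] -/
theorem IsModularFrameTestFunction.add {f g : SL(2, ℝ) → ℂ} (hf : IsModularFrameTestFunction f)
    (hg : IsModularFrameTestFunction g) : IsModularFrameTestFunction (f + g) := by
  obtain ⟨⟨F, hF, hfF⟩, hfi, Yf, hYf⟩ := hf
  obtain ⟨⟨G, hG, hgG⟩, hgi, Yg, hYg⟩ := hg
  refine ⟨⟨F + G, hF.add hG, fun x => by simp [hfF x, hgG x]⟩, fun γ x => by simp [hfi γ x, hgi γ x],
    ⟨max Yf Yg, fun x hx hY => ?_⟩⟩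
  simp [hYf x hx (lt_of_le_of_lt (le_max_left _ _) hY), hYg x hx (lt_of_le_of_lt (le_max_right _ _) hY)]

/-- Closure under scalar multiplication. [folklore] -/
theorem IsModularFrameTestFunction.const_smul {f : SL(2, ℝ) → ℂ} (hf : IsModularFrameTestFunction f)
    (a : ℂ) : IsModularFrameTestFunction (a • f) := by
  obtain ⟨⟨F, hF, hfF⟩, hfi, Yf, hYf⟩ := hf
  exact ⟨⟨a • F, hF.const_smul a, fun x => by simp [hfF x]⟩, fun γ x => by simp [hfi γ x],
    ⟨Yf, fun x hx hY => by simp [hYf x hx hY]⟩⟩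

/-- Left invariance in the form used for closed horocycles: `f (n(1) g) = f g` with
`n(1) = (1 1; 0 1) = ModularGroup.T`. [folklore] -/
theorem IsModularFrameTestFunction.apply_T_mul {f : SL(2, ℝ) → ℂ} (hf : IsModularFrameTestFunction f)
    (g : SL(2, ℝ)) : f ((ModularGroup.T : SL(2, ℝ)) * g) = f g :=
  hf.2.1 ModularGroup.T g

end Literature.Dynamics.Homogeneous

end
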